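import Mathlib
import HarnessLib
import Literature.Analysis.FluidPDE.VectorCalculus
import Literature.Analysis.FluidPDE.SphereIntegral
import Summits.NavierStokesRegularity.NavierStokesRegularity.Theorems.UnthreadedDoorAntidynamoWallShellMeanBounds

/-!
# Route `UnthreadedDoor` / `ThreadingFlux`, crux `PoloidalLiouville` (stmt-NavierStokesRegularity-1222), antidynamo v2 skeleton
# (sha16 `4ebf5683127b`), WALL `stub_scalarLiouville`: the shell-oscillation bound in the SPHERICAL-MEAN GAUGE and its ball obstruction

Support file (seat leafhand-ns-unthreadeddoor-2 g5, cell decomp-ns), `--supports stmt-NavierStokesRegularity-1222 --as helper`; theorems only.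
Continues `…WallShellMean` / `…WallShellMeanBounds` / `…WallShellMeanBall`.

WHY THIS GAUGE.  The ray gauge `T − T(x₀ + ‖x − x₀‖ n₀)` of `…WallShellMeanBall` is Lipschitz but not `C¹` at the centre (`T ≈ ⟪a(t), y⟫` there),
so a scalar built on it cannot lie in the elementary solution class of KNSS's Lemma 2.1 (tree `KNSS2009_lemma21_halfball`, `C²` slices on all
of `ℝ³`).  The SPHERICAL-MEAN gauge `T − T̄(‖x − x₀‖)`, `T̄(r) = σ(S²)⁻¹ ∫_{S²} T(x₀ + rα) dσ(α)` (`σ = volume.toSphere`, tree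
`Literature.Analysis.FluidPDE.sphereIntegral`), is the smooth canonical normalisation; this file transports the obstruction to it.

* ★★ `sphereMean_sub_ray_weighted_le` — in the wall's slice class (`v ∈ C^∞`, `‖v‖ ≤ V`, `T ∈ C^∞(ℝ³ ∖ {x₀})`, `curl v = ∇T × (x − x₀)` off
  `x₀`), for every unit `n₀` and `0 < R₁ ≤ R₂`:
  `|∫_{R₁}^{R₂} r (∫_{S²} T(x₀ + rα) dσ(α) − σ(S²) T(x₀ + r n₀)) dr| ≤ σ(S²) (2V(R₂ − R₁) + πV(R₁ + R₂))`
  — integrate the two-ray bound `ShellMean.weightedShell_oscillation_le_pi` over `α ∈ S²` and swap the integrals (Fubini on `[R₁,R₂] × S²`).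
* ★ `le_of_sphereMean_segment_ge` — if `T(x₀ + rn) − T̄(r) ≥ μ` for `r ∈ [R₁, R₂]` then `μ R₁ (R₂ − R₁) ≤ 2V(R₂ − R₁) + πV(R₁ + R₂)`.
* ★★ `le_div_of_ball_ge_sphereMean` — `T − T̄(‖· − x₀‖) ≥ μ` on a ball `B(y₀, ρ)` (off `x₀`) ⇒ `μ ≤ (4 + 6π) V/ρ` (near case: a whole sphere
  about `x₀` inside the ball, on which the mean-zero function cannot be `≥ μ > 0`; far case: a radial segment of the ball).
* ★★ `not_halfballs_sphereMean` — with the wall's time-dependent binders, NO `M₁ > 0` admits the half-ball conclusion of Lemma 2.1 for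
  `F(t,y) = T(t,y) − T̄(t, ‖y − x₀‖)`.

HONEST LABEL: slice-wise kinematics + the KNSS interface in the smooth gauge; the ENGINE (membership of `F` or a sibling in Lemma 2.1's class,
or a subsolution variant) is NOT supplied and is the open content of the wall; nothing here proves `stub_scalarLiouville`,
`PoloidalLiouville` (1222) or bears on Navier–Stokes regularity; no summit statement is proved. [folklore]
[cite: KochNadirashviliSereginSverak2009, Lemma 2.1 (arXiv:0709.3599 p. 5) and proof of Thm 5.2 (p. 10)]
-/

noncomputable section

-- the summit and its single sub-problem share the name (CONVENTIONS §1)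
set_option linter.dupNamespace false

open scoped Topology InnerProductSpace RealInnerProductSpace ContDiff
open Filter Set Function Metric MeasureTheory intervalIntegral
open Literature.Analysis.FluidPDE

namespace Summit.NavierStokesRegularity.NavierStokesRegularity.Theorems.PoloidalLiouville.Antidynamo

namespace ShellMean

/-! ### §8 The sphere measure: positivity, and integrability of continuous slices -/

/-- The sphere measure `volume.toSphere` on `S² ⊂ ℝ³` has positive finite total mass. [folklore] -/
theorem toSphere_real_univ_pos :
    0 < ((volume : Measure (EuclideanSpace ℝ (Fin 3))).toSphere).real univ := by
  haveI : Nontrivial (EuclideanSpace ℝ (Fin 3)) :=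
    Module.nontrivial_of_finrank_pos (R := ℝ) (by rw [finrank_euclideanSpace_fin]; norm_num)
  rw [measureReal_def]
  refine ENNReal.toReal_pos ?_ (measure_ne_top _ _)
  rw [Ne, Measure.measure_univ_eq_zero]
  exact Measure.toSphere_ne_zero _

/-- A continuous function on the unit sphere is integrable for the sphere measure (compact sphere, finite measure). [folklore] -/
theorem integrable_toSphere_of_continuous {f : sphere (0 : EuclideanSpace ℝ (Fin 3)) 1 → ℝ} (hf : Continuous f) :
    Integrable f ((volume : Measure (EuclideanSpace ℝ (Fin 3))).toSphere) :=
  hf.integrable_of_hasCompactSupport (HasCompactSupport.of_compactSpace _)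

/-- `x₀ + r α ≠ x₀` for `α` on the unit sphere and `r ≠ 0`. [folklore] -/
theorem centre_add_smul_sphere_ne {x₀ : EuclideanSpace ℝ (Fin 3)} (α : sphere (0 : EuclideanSpace ℝ (Fin 3)) 1)
    {r : ℝ} (hr : r ≠ 0) : x₀ + r • (α : EuclideanSpace ℝ (Fin 3)) ≠ x₀ :=
  centre_add_smul_ne (norm_eq_of_mem_sphere α) hr

/-- Continuity of the slice `α ↦ T(x₀ + rα)` on the unit sphere, for `T` continuous off `x₀` and `r ≠ 0`. [folklore] -/
theorem continuous_sphere_slice {T : EuclideanSpace ℝ (Fin 3) → ℝ} {x₀ : EuclideanSpace ℝ (Fin 3)}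
    (hTc : ContinuousOn T {x₀}ᶜ) {r : ℝ} (hr : r ≠ 0) :
    Continuous fun α : sphere (0 : EuclideanSpace ℝ (Fin 3)) 1 => T (x₀ + r • (α : EuclideanSpace ℝ (Fin 3))) := by
  have hpath : Continuous fun α : sphere (0 : EuclideanSpace ℝ (Fin 3)) 1 =>
      x₀ + r • (α : EuclideanSpace ℝ (Fin 3)) :=
    continuous_const.add (continuous_subtype_val.const_smul r)
  exact hTc.comp_continuous hpath fun α => centre_add_smul_sphere_ne α hr

/-- The sphere integral of the translate is the integral of the slice: `sphereIntegral volume (T(x₀ + ·)) r = ∫ T(x₀ + rα) dσ(α)`. [folklore] -/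
theorem sphereIntegral_translate (T : EuclideanSpace ℝ (Fin 3) → ℝ) (x₀ : EuclideanSpace ℝ (Fin 3)) (r : ℝ) :
    sphereIntegral volume (fun z => T (x₀ + z)) r =
      ∫ α, T (x₀ + r • (α : EuclideanSpace ℝ (Fin 3))) ∂((volume : Measure (EuclideanSpace ℝ (Fin 3))).toSphere) := by
  rw [sphereIntegral_def]

/-! ### §9 The weighted shell bound, spherical mean against a ray -/

/-- ★★ **Spherical mean against a ray.**  In the wall's slice class, for every unit `n₀` and `0 < R₁ ≤ R₂`:
`|∫_{R₁}^{R₂} r (∫_{S²} T(x₀ + rα) dσ(α) − σ(S²) T(x₀ + r n₀)) dr| ≤ σ(S²) · (2V(R₂ − R₁) + πV(R₁ + R₂))`. [folklore] -/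
theorem sphereMean_sub_ray_weighted_le {v : EuclideanSpace ℝ (Fin 3) → EuclideanSpace ℝ (Fin 3)}
    {T : EuclideanSpace ℝ (Fin 3) → ℝ} {x₀ : EuclideanSpace ℝ (Fin 3)} {V : ℝ}
    (hv : ContDiff ℝ (⊤ : ℕ∞) v) (hV : ∀ x, ‖v x‖ ≤ V) (hT : ContDiffOn ℝ (⊤ : ℕ∞) T {x₀}ᶜ)
    (hcurl : ∀ x, x ≠ x₀ → curl v x = cross (gradient T x) (x - x₀))
    {n₀ : EuclideanSpace ℝ (Fin 3)} (hn₀ : ‖n₀‖ = 1) {R₁ R₂ : ℝ} (hR₁ : 0 < R₁) (hR : R₁ ≤ R₂) :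
    |∫ r in R₁..R₂, r * (sphereIntegral volume (fun z => T (x₀ + z)) r
        - ((volume : Measure (EuclideanSpace ℝ (Fin 3))).toSphere).real univ * T (x₀ + r • n₀))|
      ≤ ((volume : Measure (EuclideanSpace ℝ (Fin 3))).toSphere).real univ *
          (2 * V * (R₂ - R₁) + Real.pi * V * (R₁ + R₂)) := by
  set σ : Measure (sphere (0 : EuclideanSpace ℝ (Fin 3)) 1) :=
    (volume : Measure (EuclideanSpace ℝ (Fin 3))).toSphere with hσ
  set B : ℝ := 2 * V * (R₂ - R₁) + Real.pi * V * (R₁ + R₂) with hB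
  have hTc : ContinuousOn T {x₀}ᶜ := hT.continuousOn
  -- the integrand on `ℝ × S²`
  set Φ : ℝ → sphere (0 : EuclideanSpace ℝ (Fin 3)) 1 → ℝ :=
    fun r α => r * (T (x₀ + r • (α : EuclideanSpace ℝ (Fin 3))) - T (x₀ + r • n₀)) with hΦ
  -- (1) the two-ray bound for each direction `α`
  have hray : ∀ α : sphere (0 : EuclideanSpace ℝ (Fin 3)) 1, |∫ r in R₁..R₂, Φ r α| ≤ B := fun α =>
    weightedShell_oscillation_le_pi hv hV hT hcurl (norm_eq_of_mem_sphere α) hn₀ hR₁ hR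
  -- (2) continuity of `Φ` on `[R₁, R₂] × S²`, hence a uniform bound there
  have hcontΦ : ContinuousOn (uncurry Φ) (Icc R₁ R₂ ×ˢ univ) := by
    have h1 : ContinuousOn (fun p : ℝ × sphere (0 : EuclideanSpace ℝ (Fin 3)) 1 =>
        T (x₀ + p.1 • (p.2 : EuclideanSpace ℝ (Fin 3)))) (Icc R₁ R₂ ×ˢ univ) := by
      refine hTc.comp (continuous_const.add (continuous_fst.smul
        (continuous_subtype_val.comp continuous_snd))).continuousOn fun p hp => ?_
      exact centre_add_smul_sphere_ne p.2 (lt_of_lt_of_le hR₁ (mem_prod.mp hp).1.1).ne'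
    have h2 : ContinuousOn (fun p : ℝ × sphere (0 : EuclideanSpace ℝ (Fin 3)) 1 => T (x₀ + p.1 • n₀))
        (Icc R₁ R₂ ×ˢ univ) := by
      refine hTc.comp (continuous_const.add (continuous_fst.smul continuous_const)).continuousOn fun p hp => ?_
      exact centre_add_smul_ne hn₀ (lt_of_lt_of_le hR₁ (mem_prod.mp hp).1.1).ne'
    have h3 : ContinuousOn (fun p : ℝ × sphere (0 : EuclideanSpace ℝ (Fin 3)) 1 => p.1) (Icc R₁ R₂ ×ˢ univ) :=
      continuous_fst.continuousOn
    exact h3.mul (h1.sub h2)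
  have hcpt : IsCompact (Icc R₁ R₂ ×ˢ (univ : Set (sphere (0 : EuclideanSpace ℝ (Fin 3)) 1))) :=
    isCompact_Icc.prod isCompact_univ
  obtain ⟨C, hC⟩ := hcpt.exists_bound_of_continuousOn hcontΦ
  -- (3) integrability on the product `(volume|(R₁,R₂]) × σ`
  have hmeasI : MeasurableSet (Ioc R₁ R₂ ×ˢ (univ : Set (sphere (0 : EuclideanSpace ℝ (Fin 3)) 1))) :=
    measurableSet_Ioc.prod MeasurableSet.univ
  have hprod : ((volume : Measure ℝ).restrict (Ioc R₁ R₂)).prod σ =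
      ((volume : Measure ℝ).prod σ).restrict (Ioc R₁ R₂ ×ˢ univ) := by
    conv_lhs => rw [← Measure.restrict_univ (μ := σ)]
    rw [Measure.prod_restrict]
  have hint : Integrable (uncurry Φ) (((volume : Measure ℝ).restrict (Ioc R₁ R₂)).prod σ) := by
    have hmeas : AEStronglyMeasurable (uncurry Φ) (((volume : Measure ℝ).restrict (Ioc R₁ R₂)).prod σ) := by
      rw [hprod]
      exact (hcontΦ.mono (prod_mono Ioc_subset_Icc_self le_rfl)).aestronglyMeasurable hmeasI
    have hbnd : ∀ᵐ p ∂(((volume : Measure ℝ).restrict (Ioc R₁ R₂)).prod σ), ‖uncurry Φ p‖ ≤ C := by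
      rw [hprod]
      refine (ae_restrict_mem hmeasI).mono fun p hp => ?_
      exact hC p (prod_mono Ioc_subset_Icc_self le_rfl hp)
    haveI : IsFiniteMeasure ((volume : Measure ℝ).restrict (Ioc R₁ R₂)) :=
      ⟨by rw [Measure.restrict_apply_univ]; exact measure_Ioc_lt_top⟩
    exact Integrable.mono' (integrable_const C) hmeas hbnd
  -- (4) Fubini: swap the integrals
  have hswap : ∫ r in Ioc R₁ R₂, (∫ α, Φ r α ∂σ) = ∫ α, (∫ r in Ioc R₁ R₂, Φ r α) ∂σ :=
    integral_integral_swap hint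
  -- (5) the inner `α`-integral at fixed `r > 0`
  have hinner : ∀ r ∈ Ioc R₁ R₂, ∫ α, Φ r α ∂σ =
      r * (sphereIntegral volume (fun z => T (x₀ + z)) r - σ.real univ * T (x₀ + r • n₀)) := by
    intro r hr
    have hr0 : r ≠ 0 := (lt_trans hR₁ hr.1).ne'
    have hi1 : Integrable (fun α : sphere (0 : EuclideanSpace ℝ (Fin 3)) 1 =>
        T (x₀ + r • (α : EuclideanSpace ℝ (Fin 3)))) σ :=
      integrable_toSphere_of_continuous (continuous_sphere_slice hTc hr0)
    have hi2 : Integrable (fun _ : sphere (0 : EuclideanSpace ℝ (Fin 3)) 1 => T (x₀ + r • n₀)) σ :=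
      integrable_const _
    simp only [hΦ]
    rw [MeasureTheory.integral_const_mul, integral_sub hi1 hi2, MeasureTheory.integral_const, smul_eq_mul,
      sphereIntegral_translate]
  -- (6) assemble
  have hL : ∫ r in R₁..R₂, r * (sphereIntegral volume (fun z => T (x₀ + z)) r - σ.real univ * T (x₀ + r • n₀)) =
      ∫ α, (∫ r in Ioc R₁ R₂, Φ r α) ∂σ := by
    rw [intervalIntegral.integral_of_le hR, ← hswap]
    exact (setIntegral_congr_fun measurableSet_Ioc fun r hr => (hinner r hr).symm)
  rw [hL]
  have hbound : ∀ α, ‖∫ r in Ioc R₁ R₂, Φ r α‖ ≤ B := fun α => by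
    rw [Real.norm_eq_abs, ← intervalIntegral.integral_of_le hR]
    exact hray α
  have h := norm_integral_le_of_norm_le_const (μ := σ) (Eventually.of_forall hbound)
  rw [Real.norm_eq_abs] at h
  calc |∫ α, (∫ r in Ioc R₁ R₂, Φ r α) ∂σ| ≤ B * σ.real univ := h
    _ = σ.real univ * B := mul_comm _ _

/-! ### §10 Consequences in the spherical-mean gauge: segments, whole spheres, balls, and the Lemma-2.1 interface -/

/-- The spherical mean `r ↦ ∫_{S²} T(x₀ + rα) dσ(α)` is continuous on `(0, ∞)` for `T` continuous off `x₀`. [folklore] -/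
theorem continuousOn_sphereIntegral_translate {T : EuclideanSpace ℝ (Fin 3) → ℝ} {x₀ : EuclideanSpace ℝ (Fin 3)}
    (hTc : ContinuousOn T {x₀}ᶜ) :
    ContinuousOn (sphereIntegral volume (fun z => T (x₀ + z))) (Ioi 0) := by
  refine continuousOn_sphereIntegral_Ioi volume (hTc.comp (continuous_const.add continuous_id).continuousOn ?_)
  intro z hz
  simp only [mem_compl_iff, mem_singleton_iff] at hz ⊢
  intro h
  exact hz (by simpa using h)

/-- ★ **Segment form, spherical-mean gauge.**  If `T(x₀ + rn) − T̄(r) ≥ μ` for all `r ∈ [R₁, R₂]` (`0 < R₁ ≤ R₂`, unit `n`,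
`T̄ = σ(S²)⁻¹ ∫_{S²} T(x₀ + r ·) dσ`), then `μ R₁ (R₂ − R₁) ≤ 2V(R₂ − R₁) + πV(R₁ + R₂)`. [folklore] -/
theorem le_of_sphereMean_segment_ge {v : EuclideanSpace ℝ (Fin 3) → EuclideanSpace ℝ (Fin 3)}
    {T : EuclideanSpace ℝ (Fin 3) → ℝ} {x₀ : EuclideanSpace ℝ (Fin 3)} {V μ : ℝ}
    (hv : ContDiff ℝ (⊤ : ℕ∞) v) (hV : ∀ x, ‖v x‖ ≤ V) (hT : ContDiffOn ℝ (⊤ : ℕ∞) T {x₀}ᶜ)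
    (hcurl : ∀ x, x ≠ x₀ → curl v x = cross (gradient T x) (x - x₀))
    {n : EuclideanSpace ℝ (Fin 3)} (hn : ‖n‖ = 1) {R₁ R₂ : ℝ} (hR₁ : 0 < R₁) (hR : R₁ ≤ R₂)
    (hμ : ∀ r ∈ Icc R₁ R₂, μ ≤ T (x₀ + r • n) -
      sphereIntegral volume (fun z => T (x₀ + z)) r / ((volume : Measure (EuclideanSpace ℝ (Fin 3))).toSphere).real univ) :
    μ * R₁ * (R₂ - R₁) ≤ 2 * V * (R₂ - R₁) + Real.pi * V * (R₁ + R₂) := by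
  set σ₀ : ℝ := ((volume : Measure (EuclideanSpace ℝ (Fin 3))).toSphere).real univ with hσ₀
  have hσpos : 0 < σ₀ := toSphere_real_univ_pos
  have hV0 : 0 ≤ V := le_trans (norm_nonneg _) (hV 0)
  have hb := sphereMean_sub_ray_weighted_le hv hV hT hcurl hn hR₁ hR
  by_cases hμ0 : μ ≤ 0
  · have h1 : μ * R₁ * (R₂ - R₁) ≤ 0 :=
      mul_nonpos_of_nonpos_of_nonneg (mul_nonpos_of_nonpos_of_nonneg hμ0 hR₁.le) (sub_nonneg.mpr hR)
    have h2 : 0 ≤ 2 * V * (R₂ - R₁) := mul_nonneg (mul_nonneg two_pos.le hV0) (sub_nonneg.mpr hR)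
    have h3 : 0 ≤ Real.pi * V * (R₁ + R₂) := mul_nonneg (mul_nonneg Real.pi_pos.le hV0) (by linarith)
    linarith
  push Not at hμ0
  -- continuity of the integrand on `[R₁, R₂]`
  have hTc : ContinuousOn T {x₀}ᶜ := hT.continuousOn
  have hpath : Continuous fun r : ℝ => x₀ + r • n := continuous_const.add (continuous_id.smul continuous_const)
  have hTn : ContinuousOn (fun r : ℝ => T (x₀ + r • n)) (Icc R₁ R₂) := by
    refine hTc.comp hpath.continuousOn fun r hr => ?_
    exact centre_add_smul_ne hn (lt_of_lt_of_le hR₁ hr.1).ne'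
  have hS : ContinuousOn (fun r : ℝ => sphereIntegral volume (fun z => T (x₀ + z)) r) (Icc R₁ R₂) :=
    (continuousOn_sphereIntegral_translate hTc).mono fun r hr => lt_of_lt_of_le hR₁ hr.1
  have hcont : ContinuousOn (fun r : ℝ => r * (sphereIntegral volume (fun z => T (x₀ + z)) r - σ₀ * T (x₀ + r • n)))
      (Icc R₁ R₂) := continuousOn_id.mul (hS.sub (continuousOn_const.mul hTn))
  -- upper bound of the integral by `−σ₀ μ R₁ (R₂ − R₁)`
  have hup : ∫ r in R₁..R₂, r * (sphereIntegral volume (fun z => T (x₀ + z)) r - σ₀ * T (x₀ + r • n)) ≤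
      ∫ r in R₁..R₂, -(σ₀ * μ * R₁) := by
    refine intervalIntegral.integral_mono_on hR ?_ intervalIntegrable_const fun r hr => ?_
    · exact (hcont.mono (by rw [uIcc_of_le hR])).intervalIntegrable
    · have h1 := hμ r hr
      have h2 : R₁ ≤ r := hr.1
      have hr0 : 0 < r := lt_of_lt_of_le hR₁ h2
      -- `σ₀ (T − S/σ₀) = σ₀ T − S ≥ σ₀ μ`
      have h3 : σ₀ * μ ≤ σ₀ * T (x₀ + r • n) - sphereIntegral volume (fun z => T (x₀ + z)) r := by
        have := mul_le_mul_of_nonneg_left h1 hσpos.le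
        rw [mul_sub, mul_div_cancel₀ _ hσpos.ne'] at this
        exact this
      have h4 : r * (sphereIntegral volume (fun z => T (x₀ + z)) r - σ₀ * T (x₀ + r • n)) ≤ r * (-(σ₀ * μ)) :=
        mul_le_mul_of_nonneg_left (by linarith) hr0.le
      have h5 : r * (-(σ₀ * μ)) ≤ R₁ * (-(σ₀ * μ)) := by
        have : 0 ≤ σ₀ * μ := mul_nonneg hσpos.le hμ0.le
        nlinarith
      linarith
  rw [intervalIntegral.integral_const, smul_eq_mul] at hup
  have habs := neg_abs_le (∫ r in R₁..R₂, r * (sphereIntegral volume (fun z => T (x₀ + z)) r - σ₀ * T (x₀ + r • n)))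
  -- `σ₀ μ R₁ (R₂ − R₁) ≤ σ₀ B`, then divide by `σ₀`
  have h6 : σ₀ * (μ * R₁ * (R₂ - R₁)) ≤ σ₀ * (2 * V * (R₂ - R₁) + Real.pi * V * (R₁ + R₂)) := by nlinarith
  exact le_of_mul_le_mul_left h6 hσpos

/-- ★ **Whole-sphere form**: the mean-zero deviation cannot be `≥ μ > 0` on a whole sphere — if `T(x₀ + rα) − T̄(r) ≥ μ` for every
`α ∈ S²` (`r ≠ 0`), then `μ ≤ 0`. [folklore] -/
theorem nonpos_of_sphereMean_deviation_ge_on_sphere {T : EuclideanSpace ℝ (Fin 3) → ℝ} {x₀ : EuclideanSpace ℝ (Fin 3)} {μ r : ℝ}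
    (hTc : ContinuousOn T {x₀}ᶜ) (hr : r ≠ 0)
    (hμ : ∀ α : sphere (0 : EuclideanSpace ℝ (Fin 3)) 1, μ ≤ T (x₀ + r • (α : EuclideanSpace ℝ (Fin 3))) -
      sphereIntegral volume (fun z => T (x₀ + z)) r / ((volume : Measure (EuclideanSpace ℝ (Fin 3))).toSphere).real univ) :
    μ ≤ 0 := by
  set σ : Measure (sphere (0 : EuclideanSpace ℝ (Fin 3)) 1) :=
    (volume : Measure (EuclideanSpace ℝ (Fin 3))).toSphere with hσ
  have hσpos : 0 < σ.real univ := toSphere_real_univ_pos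
  have hi1 : Integrable (fun α : sphere (0 : EuclideanSpace ℝ (Fin 3)) 1 =>
      T (x₀ + r • (α : EuclideanSpace ℝ (Fin 3)))) σ :=
    integrable_toSphere_of_continuous (continuous_sphere_slice hTc hr)
  have hi2 : Integrable (fun α : sphere (0 : EuclideanSpace ℝ (Fin 3)) 1 =>
      T (x₀ + r • (α : EuclideanSpace ℝ (Fin 3))) - sphereIntegral volume (fun z => T (x₀ + z)) r / σ.real univ) σ :=
    hi1.sub (integrable_const _)
  have hmono := integral_mono (integrable_const μ) hi2 fun α => hμ α
  rw [MeasureTheory.integral_const, smul_eq_mul, integral_sub hi1 (integrable_const _), MeasureTheory.integral_const,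
    smul_eq_mul, ← sphereIntegral_translate, mul_div_cancel₀ _ hσpos.ne', sub_self] at hmono
  -- `σ(S²) μ ≤ 0`
  nlinarith

/-- ★★ **Ball obstruction, spherical-mean gauge.**  In the wall's slice class, if `T(x) − T̄(‖x − x₀‖) ≥ μ` for every `x ≠ x₀` in a ball
`B(y₀, ρ)`, then `μ ≤ (4 + 6π) V / ρ`. [folklore] -/
theorem le_div_of_ball_ge_sphereMean {v : EuclideanSpace ℝ (Fin 3) → EuclideanSpace ℝ (Fin 3)}
    {T : EuclideanSpace ℝ (Fin 3) → ℝ} {x₀ : EuclideanSpace ℝ (Fin 3)} {V μ : ℝ}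
    (hv : ContDiff ℝ (⊤ : ℕ∞) v) (hV : ∀ x, ‖v x‖ ≤ V) (hT : ContDiffOn ℝ (⊤ : ℕ∞) T {x₀}ᶜ)
    (hcurl : ∀ x, x ≠ x₀ → curl v x = cross (gradient T x) (x - x₀))
    {y₀ : EuclideanSpace ℝ (Fin 3)} {ρ : ℝ} (hρ : 0 < ρ)
    (hμ : ∀ x ∈ ball y₀ ρ, x ≠ x₀ → μ ≤ T x -
      sphereIntegral volume (fun z => T (x₀ + z)) ‖x - x₀‖ / ((volume : Measure (EuclideanSpace ℝ (Fin 3))).toSphere).real univ) :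
    μ ≤ (4 + 6 * Real.pi) * V / ρ := by
  have hV0 : 0 ≤ V := le_trans (norm_nonneg _) (hV 0)
  have hRHS : 0 ≤ (4 + 6 * Real.pi) * V / ρ := by positivity
  set D : ℝ := ‖y₀ - x₀‖ with hD
  by_cases hnear : D ≤ ρ / 2
  · -- the whole sphere of radius `ρ/4` about `x₀` lies in the ball: the mean-zero deviation cannot be `≥ μ > 0` there
    have hr : (ρ / 4 : ℝ) ≠ 0 := by positivity
    refine (nonpos_of_sphereMean_deviation_ge_on_sphere (r := ρ / 4) hT.continuousOn hr fun α => ?_).trans hRHS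
    have hne : x₀ + (ρ / 4) • (α : EuclideanSpace ℝ (Fin 3)) ≠ x₀ := centre_add_smul_sphere_ne α hr
    have hnorm : ‖x₀ + (ρ / 4) • (α : EuclideanSpace ℝ (Fin 3)) - x₀‖ = ρ / 4 := by
      rw [add_sub_cancel_left, norm_smul, norm_eq_of_mem_sphere α, mul_one, Real.norm_eq_abs, abs_of_pos (by positivity)]
    have hmem : x₀ + (ρ / 4) • (α : EuclideanSpace ℝ (Fin 3)) ∈ ball y₀ ρ := by
      rw [mem_ball, dist_eq_norm]
      calc ‖x₀ + (ρ / 4) • (α : EuclideanSpace ℝ (Fin 3)) - y₀‖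
            = ‖(x₀ + (ρ / 4) • (α : EuclideanSpace ℝ (Fin 3)) - x₀) - (y₀ - x₀)‖ := by congr 1; abel
        _ ≤ ‖x₀ + (ρ / 4) • (α : EuclideanSpace ℝ (Fin 3)) - x₀‖ + ‖y₀ - x₀‖ := norm_sub_le _ _
        _ = ρ / 4 + D := by rw [hnorm, hD]
        _ < ρ := by linarith
    have h := hμ _ hmem hne
    rw [hnorm] at h
    exact h
  · -- the far case: a radial segment of length `ρ/2` inside the ball
    push Not at hnear
    have hDpos : 0 < D := lt_trans (by positivity) hnear
    set n : EuclideanSpace ℝ (Fin 3) := D⁻¹ • (y₀ - x₀) with hn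
    have hn1 : ‖n‖ = 1 := by
      rw [hn, norm_smul, norm_inv, Real.norm_eq_abs, abs_of_pos hDpos, ← hD, inv_mul_cancel₀ hDpos.ne']
    have hyn : y₀ - x₀ = D • n := by
      rw [hn, smul_smul, mul_inv_cancel₀ hDpos.ne', one_smul]
    have hseg : ∀ r ∈ Icc D (D + ρ / 2), μ ≤ T (x₀ + r • n) -
        sphereIntegral volume (fun z => T (x₀ + z)) r / ((volume : Measure (EuclideanSpace ℝ (Fin 3))).toSphere).real univ := by
      intro r hr
      have hr0 : 0 < r := lt_of_lt_of_le hDpos hr.1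
      have hnorm : ‖x₀ + r • n - x₀‖ = r := by
        rw [add_sub_cancel_left, norm_smul, hn1, mul_one, Real.norm_eq_abs, abs_of_pos hr0]
      have hmem : x₀ + r • n ∈ ball y₀ ρ := by
        rw [mem_ball, dist_eq_norm]
        have : x₀ + r • n - y₀ = (r - D) • n := by
          rw [sub_smul, ← hyn]; abel
        rw [this, norm_smul, hn1, mul_one, Real.norm_eq_abs, abs_of_nonneg (by linarith [hr.1])]
        linarith [hr.2]
      have h := hμ _ hmem (centre_add_smul_ne hn1 hr0.ne')
      rw [hnorm] at h
      exact h
    have h := le_of_sphereMean_segment_ge hv hV hT hcurl hn1 hDpos (by linarith) hseg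
    have h1 : μ * D * (D + ρ / 2 - D) = (μ * D) * (ρ / 2) := by ring
    rw [h1] at h
    by_cases hμ0 : μ ≤ 0
    · exact hμ0.trans hRHS
    push Not at hμ0
    rw [le_div_iff₀ hρ]
    have h2 : μ * D * ρ ≤ 2 * V * ρ + Real.pi * V * (4 * D + ρ) := by linarith
    have hρD : ρ ≤ 2 * D := by linarith
    have e1 : 2 * V * ρ ≤ 2 * V * (2 * D) := mul_le_mul_of_nonneg_left hρD (by positivity)
    have e2 : Real.pi * V * ρ ≤ Real.pi * V * (2 * D) :=
      mul_le_mul_of_nonneg_left hρD (mul_nonneg Real.pi_pos.le hV0)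
    have h4 : μ * ρ * D ≤ (4 + 6 * Real.pi) * V * D := by linarith
    exact le_of_mul_le_mul_right h4 hDpos

/-- ★★ **No half-balls in the spherical-mean gauge** (wall binders).  For `v` jointly smooth on the slab and bounded by `V`, `T` jointly
smooth on the punctured slab with `curl v(t) = ∇T(t) × (x − x₀)`, NO `M₁ > 0` admits the conclusion of KNSS's Lemma 2.1 (`f ≥ M₁/2` on
parabolic balls of every radius) for the smooth-gauge deviation `f(t,y) = T(t,y) − T̄(t, ‖y − x₀‖)`. [folklore] -/
theorem not_halfballs_sphereMean
    {v : ℝ → EuclideanSpace ℝ (Fin 3) → EuclideanSpace ℝ (Fin 3)} {x₀ : EuclideanSpace ℝ (Fin 3)}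
    {T : ℝ → EuclideanSpace ℝ (Fin 3) → ℝ} {V M₁ : ℝ}
    (hsm : ContDiffOn ℝ (⊤ : ℕ∞) (Function.uncurry v) (Set.Iio 0 ×ˢ Set.univ))
    (hsT : ContDiffOn ℝ (⊤ : ℕ∞) (Function.uncurry T) (Set.Iio 0 ×ˢ ({x₀}ᶜ : Set (EuclideanSpace ℝ (Fin 3)))))
    (hV : ∀ t < 0, ∀ x, ‖v t x‖ ≤ V)
    (hrep : ∀ t < 0, ∀ x, curl (v t) x = cross (gradient (T t) x) (x - x₀)) (hM₁ : 0 < M₁) :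
    ¬ ∀ R > 0, ∃ y₀ : EuclideanSpace ℝ (Fin 3), ∃ t₀ < (0 : ℝ),
        ∀ t ∈ Ioo (t₀ - R ^ 2) t₀, ∀ y ∈ ball y₀ R, y ≠ x₀ →
          M₁ / 2 ≤ T t y - sphereIntegral volume (fun z => T t (x₀ + z)) ‖y - x₀‖ /
            ((volume : Measure (EuclideanSpace ℝ (Fin 3))).toSphere).real univ := by
  intro hball
  have hV0 : 0 ≤ V := le_trans (norm_nonneg _) (hV (-1) (by norm_num) 0)
  set R : ℝ := 4 * (4 + 6 * Real.pi) * V / M₁ + 1 with hR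
  have hRpos : 0 < R := by positivity
  obtain ⟨y₀, t₀, ht₀, h⟩ := hball R hRpos
  set t : ℝ := t₀ - R ^ 2 / 2 with ht
  have htI : t ∈ Ioo (t₀ - R ^ 2) t₀ := by
    constructor <;> · rw [ht]; nlinarith
  have htneg : t < 0 := lt_trans htI.2 ht₀
  have hι : ContDiff ℝ (⊤ : ℕ∞) fun x : EuclideanSpace ℝ (Fin 3) => (t, x) := contDiff_prodMk_right t
  have hv : ContDiff ℝ (⊤ : ℕ∞) (v t) := hsm.comp_contDiff hι fun x => ⟨htneg, Set.mem_univ x⟩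
  have hT : ContDiffOn ℝ (⊤ : ℕ∞) (T t) ({x₀}ᶜ) := hsT.comp hι.contDiffOn fun x hx => ⟨htneg, hx⟩
  have hobs := le_div_of_ball_ge_sphereMean hv (hV t htneg) hT (fun x _ => hrep t htneg x) hRpos
    (fun y hy hyx => h t htI y hy hyx)
  rw [le_div_iff₀ hRpos] at hobs
  have hRM : M₁ / 2 * R = 2 * ((4 + 6 * Real.pi) * V) + M₁ / 2 := by
    rw [hR]
    field_simp
    ring
  have hK : 0 ≤ (4 + 6 * Real.pi) * V := mul_nonneg (by positivity) hV0
  linarith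

end ShellMean

end Summit.NavierStokesRegularity.NavierStokesRegularity.Theorems.PoloidalLiouville.Antidynamo
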